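import Summits.NavierStokesRegularity.NavierStokesRegularity.Theorems.SqueezeCycleExtremalBiaxialitySubcriticalOfLiouville
import Literature.Analysis.FluidPDE.KNSSTypeIRateLiouvilleHolds
import HarnessLib

/-!
# Route `SqueezeCycle`, crux `ExtremalBiaxialitySubcritical` — symmetric elements of `𝒦_C` are trivial

Helper file for item `stmt-NavierStokesRegularity-11609`
(`Summit.NavierStokesRegularity.NavierStokesRegularity.Theses.SqueezeCycle.ExtremalBiaxialitySubcritical`).
The card's layer-2 endpoint K3 ("polyhedral squeezing ⇒ symmetric extremal element ⇒ known
symmetric Type-I exclusions") needs the symmetric Liouville theorems on the route's class. Three of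
them are theorems of the tree (Koch–Nadirashvili–Seregin–Šverák 2009, Thms 5.1–5.3 and the
Liouville step of Thm 6.2), and transfer to Type-I KNSS-mild ancient fields
(`Literature.Analysis.FluidPDE.IsTypeIAncientMild`, = the route's inline class by
`isTypeIAncientMild_of_squeezeClass`) through the time shift `t ↦ u(t − δ)`, which makes the field
bounded (`IsTypeIAncientMild.isBoundedAncientMildSolution_sub`, `….comp_sub_right`):

* `typeIAncientMild_eq_zero_of_planarInvariant` — a field independent of one Cartesian coordinate
  vanishes (`KNSS2009_typeI_rate_liouville_holds`: Thm 5.1 made Type-I);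
* `typeIAncientMild_eq_zero_of_axisymmetric_noSwirl` — an axisymmetric field without swirl
  vanishes (`knss2009_axisymmetric_no_swirl_holds`, Thm 5.2: the slices are constant multiples of
  `e_z`, and slice-constant elements are killed by the Oseen gauge and the Type-I rate,
  `IsTypeIAncientMild.eq_zero_of_slice_const`);
* `typeIAncientMild_eq_zero_of_axisymmetric_of_cylRadius_mul_norm_le` — an axisymmetric field
  with `|x'| ‖u‖ ≤ K` vanishes (`knss_bound_C_over_r_holds`, Thm 5.3).

Consequently the crux holds — without its maximality clause — at every extremal element of one of
these three kinds (`extremalBiaxialitySubcritical_of_planarInvariant`, `…_of_axisymmetric_noSwirl`,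
`…_of_axisymmetric_of_cylRadius_mul_norm_le`): an extremal squeeze site is genuinely
three-dimensional, and if axisymmetric it swirls and violates `|x'| ‖u‖ ≤ K`.
-/

noncomputable section

open MeasureTheory Set Function Filter
open scoped RealInnerProductSpace

namespace Summit.NavierStokesRegularity.NavierStokesRegularity.Theorems

open Literature.Analysis.FluidPDE
open Summit.NavierStokesRegularity.NavierStokesRegularity.Theses

/-! ### Planar elements -/

/-- **A Type-I KNSS-mild ancient field independent of one Cartesian coordinate vanishes**
(KNSS 2009, the Liouville step of the proof of Thm 6.2, in the tree as the theorem
`KNSS2009_typeI_rate_liouville_holds`: a bounded, jointly continuous, weakly divergence-free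
solution of the Oseen integral equation on `(−∞,0)`, invariant under `x ↦ x + δe₁` and with
`√(−t)‖W(t,x)‖ ≤ C`, is zero). The field `u` itself is unbounded as `t ↑ 0`, so the theorem is
applied to the time-shifted field `W(t) = u(t − δ)`, `δ = −t/2 > 0`, which is bounded by `C/√δ`,
inherits the invariance, the mild identity and the rate `‖W(t)‖ ≤ C/√(δ−t) ≤ C/√(−t)`
(`IsTypeIAncientMild.comp_sub_right`). [cite: KochNadirashviliSereginSverak2009, proof of Thm 6.2 (arXiv:0709.3599 p. 13) with Thm 5.1] -/
theorem typeIAncientMild_eq_zero_of_planarInvariant {C : ℝ}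
    {u : ℝ → EuclideanSpace ℝ (Fin 3) → EuclideanSpace ℝ (Fin 3)} (h : IsTypeIAncientMild C u)
    (hinv : ∀ t < 0, ∀ (x : EuclideanSpace ℝ (Fin 3)) (δ : ℝ),
      u t (x + EuclideanSpace.single 1 δ) = u t x)
    {t : ℝ} (ht : t < 0) (x : EuclideanSpace ℝ (Fin 3)) : u t x = 0 := by
  set δ : ℝ := -t / 2 with hδ
  have hδ0 : 0 < δ := by rw [hδ]; linarith
  set W : ℝ → EuclideanSpace ℝ (Fin 3) → EuclideanSpace ℝ (Fin 3) := fun s => u (s - δ) with hW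
  have hWT : IsTypeIAncientMild C W := h.comp_sub_right hδ0.le
  have hbdd : ∃ K : ℝ, ∀ s < 0, ∀ y, ‖W s y‖ ≤ K := by
    obtain ⟨K, hK⟩ := h.isBoundedOn hδ0
    exact ⟨K, fun s hs y => hK (s - δ) (by simp only [mem_Iio]; linarith) y⟩
  have hWinv : ∀ s < 0, ∀ (y : EuclideanSpace ℝ (Fin 3)) (δ' : ℝ),
      W s (y + EuclideanSpace.single 1 δ') = W s y :=
    fun s hs y δ' => hinv (s - δ) (by linarith) y δ'
  have hrate : ∀ s < 0, ∀ y, Real.sqrt (-s) * ‖W s y‖ ≤ C := by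
    intro s hs y
    have hsq : 0 < Real.sqrt (-s) := Real.sqrt_pos.2 (by linarith)
    rw [mul_comm, ← le_div_iff₀ hsq]
    exact hWT.norm_le hs y
  have hzero : ∀ s < 0, ∀ y, W s y = 0 :=
    KNSS2009_typeI_rate_liouville_holds hWT.continuousOn_uncurry hbdd
      (fun s hs => hWT.isWeaklyDivFree hs) (fun s s' hss' hs' y => hWT.mild_eq_heatExtension hss' hs' y)
      hWinv hrate
  have key := hzero (t + δ) (by rw [hδ]; linarith) x
  simpa only [hW, add_sub_cancel_right] using key

/-! ### Axisymmetric elements without swirl -/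

/-- **An axisymmetric Type-I KNSS-mild ancient field without swirl vanishes** (KNSS 2009,
Thm 5.2, in the tree as `knss2009_axisymmetric_no_swirl_holds`: a bounded ancient mild solution in
`L^∞(ℝ³ × (−∞,0))`, axisymmetric with no swirl, has slices a.e. equal to `β(t) e_z`). Applied to
the time-shifted field `W(t) = u(t − δ)` (bounded, `IsTypeIAncientMild.isBoundedAncientMildSolution_sub`;
jointly continuous, hence measurable): its continuous slices are then constant, and a
slice-constant Type-I KNSS-mild field is zero (`IsTypeIAncientMild.eq_zero_of_slice_const`: the
Oseen gauge fixes the constant, the Type-I rate sends it to `0`). [cite: KochNadirashviliSereginSverak2009, Thm 5.2 (arXiv:0709.3599 pp. 9–10) and Remark 6.1] -/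
theorem typeIAncientMild_eq_zero_of_axisymmetric_noSwirl {C : ℝ}
    {u : ℝ → EuclideanSpace ℝ (Fin 3) → EuclideanSpace ℝ (Fin 3)} (h : IsTypeIAncientMild C u)
    (haxi : ∀ t < 0, IsAxisymmetric (u t)) (hsw : ∀ t < 0, HasNoSwirl (u t))
    {t : ℝ} (ht : t < 0) (x : EuclideanSpace ℝ (Fin 3)) : u t x = 0 := by
  set δ : ℝ := -t / 2 with hδ
  have hδ0 : 0 < δ := by rw [hδ]; linarith
  set W : ℝ → EuclideanSpace ℝ (Fin 3) → EuclideanSpace ℝ (Fin 3) := fun s => u (s - δ) with hW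
  have hWT : IsTypeIAncientMild C W := h.comp_sub_right hδ0.le
  have hWB : IsBoundedAncientMildSolution 1 W := h.isBoundedAncientMildSolution_sub hδ0
  have hjoint : AEStronglyMeasurable (uncurry W)
      (volume.restrict (Iio (0 : ℝ) ×ˢ (univ : Set (EuclideanSpace ℝ (Fin 3))))) :=
    hWT.continuousOn_uncurry.aestronglyMeasurable (measurableSet_Iio.prod MeasurableSet.univ)
  have hmeas : ∀ s < 0, AEStronglyMeasurable (W s) volume := fun s hs =>
    hWT.aestronglyMeasurable_slice hs
  have hWaxi : ∀ s < 0, IsAxisymmetric (W s) := fun s hs => haxi (s - δ) (by linarith)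
  have hWsw : ∀ s < 0, HasNoSwirl (W s) := fun s hs => hsw (s - δ) (by linarith)
  -- Thm 5.2: slices are a.e. constant multiples of `e_z`, hence constant
  have hconst : ∀ s < 0, ∃ b : EuclideanSpace ℝ (Fin 3), ∀ y, W s y = b := by
    intro s hs
    obtain ⟨β, hβ⟩ := knss2009_axisymmetric_no_swirl_holds hWB hjoint hmeas hWaxi hWsw s hs
    refine ⟨β • eZ, fun y => ?_⟩
    have hc : W s = fun _ => β • eZ :=
      ((hWT.continuous_slice hs).ae_eq_iff_eq volume continuous_const).1 hβ
    exact congrFun hc y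
  choose! b hb using hconst
  have hzero : ∀ s < 0, ∀ y, W s y = 0 := fun s hs y =>
    hWT.eq_zero_of_slice_const (fun s' hs' y' => hb s' hs' y') hs y
  have key := hzero (t + δ) (by rw [hδ]; linarith) x
  simpa only [hW, add_sub_cancel_right] using key

/-! ### Axisymmetric elements with `|x'| ‖u‖ ≤ K` -/

/-- **An axisymmetric Type-I KNSS-mild ancient field with `|x'| ‖u(t,x)‖ ≤ K` vanishes**
(KNSS 2009, Thm 5.3, in the tree as `knss_bound_C_over_r_holds`: a bounded ancient mild solution,
axisymmetric, with `r‖u‖ ≤ K`, is a.e. zero on every slice). Applied to the time-shifted field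
`W(t) = u(t − δ)` (bounded), whose slices are continuous, so a.e. zero means zero. [cite: KochNadirashviliSereginSverak2009, Thm 5.3 (arXiv:0709.3599 p. 10)] -/
theorem typeIAncientMild_eq_zero_of_axisymmetric_of_cylRadius_mul_norm_le {C : ℝ}
    {u : ℝ → EuclideanSpace ℝ (Fin 3) → EuclideanSpace ℝ (Fin 3)} (h : IsTypeIAncientMild C u)
    (haxi : ∀ t < 0, IsAxisymmetric (u t))
    (hbound : ∃ K : ℝ, ∀ t < 0, ∀ x, cylRadius x * ‖u t x‖ ≤ K)
    {t : ℝ} (ht : t < 0) (x : EuclideanSpace ℝ (Fin 3)) : u t x = 0 := by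
  set δ : ℝ := -t / 2 with hδ
  have hδ0 : 0 < δ := by rw [hδ]; linarith
  set W : ℝ → EuclideanSpace ℝ (Fin 3) → EuclideanSpace ℝ (Fin 3) := fun s => u (s - δ) with hW
  have hWT : IsTypeIAncientMild C W := h.comp_sub_right hδ0.le
  have hWB : IsBoundedAncientMildSolution 1 W := h.isBoundedAncientMildSolution_sub hδ0
  have hmeas : ∀ s < 0, AEStronglyMeasurable (W s) volume := fun s hs =>
    hWT.aestronglyMeasurable_slice hs
  have hWaxi : ∀ s < 0, IsAxisymmetric (W s) := fun s hs => haxi (s - δ) (by linarith)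
  have hWbound : ∃ K : ℝ, ∀ s < 0, ∀ y, cylRadius y * ‖W s y‖ ≤ K := by
    obtain ⟨K, hK⟩ := hbound
    exact ⟨K, fun s hs y => hK (s - δ) (by linarith) y⟩
  have hzero : ∀ s < 0, ∀ y, W s y = 0 := by
    intro s hs y
    have hae : W s =ᵐ[volume] 0 := knss_bound_C_over_r_holds hWB hmeas hWaxi hWbound s hs
    have hc : W s = fun _ => 0 :=
      ((hWT.continuous_slice hs).ae_eq_iff_eq volume continuous_const).1 hae
    exact congrFun hc y
  have key := hzero (t + δ) (by rw [hδ]; linarith) x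
  simpa only [hW, add_sub_cancel_right] using key

/-! ### The crux at symmetric extremal elements -/

/-- **An extremal squeeze site never sits on a planar element of `𝒦_C`**: the crux
`ExtremalBiaxialitySubcritical` holds — without its maximality clause — at every element of the
route's inline class that is independent of the coordinate `x₂` (Lean index `1`): such an element
is a Type-I KNSS-mild field (`isTypeIAncientMild_of_squeezeClass`), hence zero
(`typeIAncientMild_eq_zero_of_planarInvariant`), so an attained middle eigenvalue `≥ m` forces
`m ≤ 0 < 1/8`. [cite: KochNadirashviliSereginSverak2009, proof of Thm 6.2 (arXiv:0709.3599 p. 13)] -/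
theorem extremalBiaxialitySubcritical_of_planarInvariant (C m : ℝ)
    (u : ℝ → EuclideanSpace ℝ (Fin 3) → EuclideanSpace ℝ (Fin 3)) (t₀ : ℝ) (x₀ : EuclideanSpace ℝ (Fin 3))
    (ht₀ : t₀ < 0)
    (hu : ContDiffOn ℝ (⊤ : ℕ∞) (Function.uncurry u) (Set.Iio 0 ×ˢ Set.univ) ∧ (∀ t < 0, Literature.Analysis.FluidPDE.VectorCalculus.IsDivFree (u t)) ∧ (∀ s t : ℝ, s < t → t < 0 → ∀ x, u t x = Literature.Analysis.FluidPDE.heatFlow (u s) (t-s) x - ∫ τ in Set.Ioo s t, ∫ y, ((-(inner ℝ (x-y) (u τ y) / (2*(t-τ)) * Literature.Analysis.UnboundedOperators.heatKernel (t-τ) (x-y))) • u τ y + (∫ σ in Set.Ioi (t-τ), Literature.Analysis.UnboundedOperators.heatKernel σ (x-y) / (4*σ^2)) • (inner ℝ (x-y) (u τ y) • u τ y + inner ℝ (u τ y) (u τ y) • (x-y) + inner ℝ (x-y) (u τ y) • u τ y) - ((∫ σ in Set.Ioi (t-τ), Literature.Analysis.UnboundedOperators.heatKernel σ (x-y) /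 (8*σ^3)) * (inner ℝ (x-y) (u τ y) * inner ℝ (x-y) (u τ y))) • (x-y))) ∧ Literature.Analysis.FluidPDE.HasTypeITimeDecay C u ∧ (∀ (x₀ : EuclideanSpace ℝ (Fin 3)) (t₀ r : ℝ), t₀ ≤ 0 → 0 < r → (∀ t, t₀ - r^2 < t → t < t₀ → r⁻¹ * ∫ x in Metric.ball x₀ r, ‖u t x‖^2 ≤ C) ∧ r⁻¹ * ∫ t in Set.Ioo (t₀ - r^2) t₀, ∫ x in Metric.ball x₀ r, ‖fderiv ℝ (u t) x‖^2 ≤ C))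
    (hinv : ∀ t < 0, ∀ (x : EuclideanSpace ℝ (Fin 3)) (δ : ℝ),
      u t (x + EuclideanSpace.single 1 δ) = u t x)
    (hGE : ∃ v w : EuclideanSpace ℝ (Fin 3), ‖v‖ = 1 ∧ ‖w‖ = 1 ∧ inner ℝ v w = 0 ∧ ∀ α β : ℝ, m * (α^2 + β^2) ≤ (-t₀) * inner ℝ (fderiv ℝ (u t₀) x₀ (α • v + β • w)) (α • v + β • w)) :
    m < 1 / 8 := by
  obtain ⟨h1, h2, h3, h4, -⟩ := hu
  have h : IsTypeIAncientMild C u := isTypeIAncientMild_of_squeezeClass h1 h2 h3 h4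
  have hz : ∀ x, u t₀ x = 0 := fun x => typeIAncientMild_eq_zero_of_planarInvariant h hinv ht₀ x
  have hm : m ≤ 0 := nonpos_of_twoFrame_lower_of_slice_zero hz hGE
  linarith

/-- **An extremal squeeze site never sits on an axisymmetric swirl-free element of `𝒦_C`**: the
crux holds — without its maximality clause — at every element of the inline class whose slices are
axisymmetric with no swirl (`typeIAncientMild_eq_zero_of_axisymmetric_noSwirl`, KNSS Thm 5.2).
[cite: KochNadirashviliSereginSverak2009, Thm 5.2 (arXiv:0709.3599 pp. 9–10)] -/
theorem extremalBiaxialitySubcritical_of_axisymmetric_noSwirl (C m : ℝ)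
    (u : ℝ → EuclideanSpace ℝ (Fin 3) → EuclideanSpace ℝ (Fin 3)) (t₀ : ℝ) (x₀ : EuclideanSpace ℝ (Fin 3))
    (ht₀ : t₀ < 0)
    (hu : ContDiffOn ℝ (⊤ : ℕ∞) (Function.uncurry u) (Set.Iio 0 ×ˢ Set.univ) ∧ (∀ t < 0, Literature.Analysis.FluidPDE.VectorCalculus.IsDivFree (u t)) ∧ (∀ s t : ℝ, s < t → t < 0 → ∀ x, u t x = Literature.Analysis.FluidPDE.heatFlow (u s) (t-s) x - ∫ τ in Set.Ioo s t, ∫ y, ((-(inner ℝ (x-y) (u τ y) / (2*(t-τ)) * Literature.Analysis.UnboundedOperators.heatKernel (t-τ) (x-y))) • u τ y + (∫ σ in Set.Ioi (t-τ), Literature.Analysis.UnboundedOperators.heatKernel σ (x-y) / (4*σ^2)) • (inner ℝ (x-y) (u τ y) • u τ y + inner ℝ (u τ y) (u τ y) • (x-y) + inner ℝ (x-y) (u τ y) • u τ y) - ((∫ σ in Set.Ioi (t-τ), Literature.Analysis.UnboundedOperators.heatKernel σ (x-y) / (8*σ^3)) * (inner ℝ (x-y) (u τ y) * inner ℝ (x-y)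 (u τ y))) • (x-y))) ∧ Literature.Analysis.FluidPDE.HasTypeITimeDecay C u ∧ (∀ (x₀ : EuclideanSpace ℝ (Fin 3)) (t₀ r : ℝ), t₀ ≤ 0 → 0 < r → (∀ t, t₀ - r^2 < t → t < t₀ → r⁻¹ * ∫ x in Metric.ball x₀ r, ‖u t x‖^2 ≤ C) ∧ r⁻¹ * ∫ t in Set.Ioo (t₀ - r^2) t₀, ∫ x in Metric.ball x₀ r, ‖fderiv ℝ (u t) x‖^2 ≤ C))
    (haxi : ∀ t < 0, IsAxisymmetric (u t)) (hsw : ∀ t < 0, HasNoSwirl (u t))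
    (hGE : ∃ v w : EuclideanSpace ℝ (Fin 3), ‖v‖ = 1 ∧ ‖w‖ = 1 ∧ inner ℝ v w = 0 ∧ ∀ α β : ℝ, m * (α^2 + β^2) ≤ (-t₀) * inner ℝ (fderiv ℝ (u t₀) x₀ (α • v + β • w)) (α • v + β • w)) :
    m < 1 / 8 := by
  obtain ⟨h1, h2, h3, h4, -⟩ := hu
  have h : IsTypeIAncientMild C u := isTypeIAncientMild_of_squeezeClass h1 h2 h3 h4
  have hz : ∀ x, u t₀ x = 0 := fun x =>
    typeIAncientMild_eq_zero_of_axisymmetric_noSwirl h haxi hsw ht₀ x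
  have hm : m ≤ 0 := nonpos_of_twoFrame_lower_of_slice_zero hz hGE
  linarith

/-- **An axisymmetric extremal squeezer violates `|x'| ‖u‖ ≤ K`**: the crux holds — without its
maximality clause — at every axisymmetric element of the inline class with `|x'| ‖u(t,x)‖ ≤ K` on
`(−∞,0) × ℝ³` (`typeIAncientMild_eq_zero_of_axisymmetric_of_cylRadius_mul_norm_le`, KNSS Thm 5.3).
[cite: KochNadirashviliSereginSverak2009, Thm 5.3 (arXiv:0709.3599 p. 10)] -/
theorem extremalBiaxialitySubcritical_of_axisymmetric_of_cylRadius_mul_norm_le (C m : ℝ)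
    (u : ℝ → EuclideanSpace ℝ (Fin 3) → EuclideanSpace ℝ (Fin 3)) (t₀ : ℝ) (x₀ : EuclideanSpace ℝ (Fin 3))
    (ht₀ : t₀ < 0)
    (hu : ContDiffOn ℝ (⊤ : ℕ∞) (Function.uncurry u) (Set.Iio 0 ×ˢ Set.univ) ∧ (∀ t < 0, Literature.Analysis.FluidPDE.VectorCalculus.IsDivFree (u t)) ∧ (∀ s t : ℝ, s < t → t < 0 → ∀ x, u t x = Literature.Analysis.FluidPDE.heatFlow (u s) (t-s) x - ∫ τ in Set.Ioo s t, ∫ y, ((-(inner ℝ (x-y) (u τ y) / (2*(t-τ)) * Literature.Analysis.UnboundedOperators.heatKernel (t-τ) (x-y))) • u τ y + (∫ σ in Set.Ioi (t-τ), Literature.Analysis.UnboundedOperators.heatKernel σ (x-y) / (4*σ^2)) • (inner ℝ (x-y) (u τ y) • u τ y + inner ℝ (u τ y) (u τ y) • (x-y) + inner ℝ (x-y) (u τ y) • u τ y) - ((∫ σ in Set.Ioi (t-τ), Literature.Analysis.UnboundedOperators.heatKernel σ (x-y) / (8*σ^3)) * (inner ℝ (x-y) (u τ y) * inner ℝ (x-y)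 (u τ y))) • (x-y))) ∧ Literature.Analysis.FluidPDE.HasTypeITimeDecay C u ∧ (∀ (x₀ : EuclideanSpace ℝ (Fin 3)) (t₀ r : ℝ), t₀ ≤ 0 → 0 < r → (∀ t, t₀ - r^2 < t → t < t₀ → r⁻¹ * ∫ x in Metric.ball x₀ r, ‖u t x‖^2 ≤ C) ∧ r⁻¹ * ∫ t in Set.Ioo (t₀ - r^2) t₀, ∫ x in Metric.ball x₀ r, ‖fderiv ℝ (u t) x‖^2 ≤ C))
    (haxi : ∀ t < 0, IsAxisymmetric (u t))
    (hbound : ∃ K : ℝ, ∀ t < 0, ∀ x, cylRadius x * ‖u t x‖ ≤ K)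
    (hGE : ∃ v w : EuclideanSpace ℝ (Fin 3), ‖v‖ = 1 ∧ ‖w‖ = 1 ∧ inner ℝ v w = 0 ∧ ∀ α β : ℝ, m * (α^2 + β^2) ≤ (-t₀) * inner ℝ (fderiv ℝ (u t₀) x₀ (α • v + β • w)) (α • v + β • w)) :
    m < 1 / 8 := by
  obtain ⟨h1, h2, h3, h4, -⟩ := hu
  have h : IsTypeIAncientMild C u := isTypeIAncientMild_of_squeezeClass h1 h2 h3 h4
  have hz : ∀ x, u t₀ x = 0 := fun x =>
    typeIAncientMild_eq_zero_of_axisymmetric_of_cylRadius_mul_norm_le h haxi hbound ht₀ x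
  have hm : m ≤ 0 := nonpos_of_twoFrame_lower_of_slice_zero hz hGE
  linarith

end Summit.NavierStokesRegularity.NavierStokesRegularity.Theorems

end
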